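import Summits.FinalStateConjecture.FinalStateConjecture.Theses.DissipativeFinalMotions
import Literature.Geometry.Lorentzian.CutBondiMass
import HarnessLib

/-!
# Birth skeleton — crux stmt-FinalStateConjecture-10993 `Theses.DissipativeFinalMotions.RadiativeLyapunovBudget` (rank 2)
# line `birth` (skeleton registrar planner-skel-stmt-FinalStateConjecture-10993-0, 2026-08-17; BC3 of run/shared/lean/lens3/_common/BC.md)

THE CRUX (RLB). For admissible data, an MGHD `𝒟` with complete `𝓘⁺` and ANY rev-2 final-era package
`(N, M, a, T, δ, V, C₁, C₂, ρ₀, κ, ξ, β, U₀, B₀, B, Ψ₀, Ψ, O)` (31 clauses = `IsFinalEra₂`, by `Iff.rfl` the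
inline hypothesis), there is `E : ℝ → ℝ`, antitone and bounded below on `[T, ∞)`, which drops by `ε(D) > 0`
within a lag `L(D)` after every unit of flat time during which two distinct labels stay `D`-close.

THE CUT follows the route header's own TWO-LAYER PLAN for this crux ("RadiativeLyapunovBudget ⇐ BondiBudget
→ LoiteringRadiates"), typed over the landed, geometry-pinned Bondi mass of a cut
`CauchyDevelopment.cutBondiMass 𝒟 K` / `HasCutBondiMass 𝒟 K m` (Literature/Geometry/Lorentzian/CutBondiMass.lean:
the infimum over asymptotically ROUND receding families of sections of `∂J⁺(K)` of their Hawking-mass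
limits — the rest mass of the cut `𝓘⁺ ∩ ∂J⁺(K)` — for an ARBITRARY late set `K` of the spacetime). The
cuts are HOLE-ADAPTED and nested BY CONSTRUCTION: for label `i`, flat time `t` and a shell radius `R₁ > ρ₀`,
`K_i(t) := Ψ₀({y ∈ U₀ | t ≤ y⁰, |y̲ − ξ_i(y⁰)| ≤ R₁})` (the flat chart's image of the solid `R₁`-tube about
the worldline `ξ_i` after flat time `t`); `s ≤ t ⇒ K_i(t) ⊆ K_i(s) ⇒ J⁺(K_i(t)) ⊆ J⁺(K_i(s))`, so the cut
of `t` is later than the cut of `s` with no appeal to the (unpinned) time orientation of the flat chart,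
and the cut of `K_i(t)` on `𝓘⁺` is the retarded time at which the neighbourhood of hole `i` is seen from
flat time `t` on. The witness is `E(t) := Σ_i cutBondiMass 𝒟 (K_i t)` — one hole-adapted Bondi clock per
label, summed (a single family of round cuts cannot register the emissions of several mutually receding
clusters within a uniform lag; per-label cuts can, and a sum of antitone ledgers taxed in one summand is
taxed).

* `stub_bondiLedger` (K — HONEST BONDI LEDGER ON HOLE-ADAPTED CUTS; size L): under the package there is
  `R₁ > ρ₀` such that for every label `i` and flat time `t ≥ T`: (EX) the cone `∂J⁺(K_i t)` carries a round
  receding family with a Hawking-mass limit (`∃ m, HasCutBondiMass`: CK-type asymptotics at `𝓘⁺` for these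
  MGHDs — complete `𝓘⁺` is given only in sojourn form); (BB) every such limit is `≥ 0` (positivity of the
  Bondi ENERGY in every asymptotic frame, Schoen–Yau / Ludvigsen–Vickers, transplanted to intrinsic round
  families); (ML) `cutBondiMass (K_i t) ≤ cutBondiMass (K_i s)` for `T ≤ s ≤ t` (Bondi mass loss between the
  causally ordered cuts `J⁺(K_i t) ⊆ J⁺(K_i s)`; for rest masses this is the reverse triangle inequality
  for the radiated four-momentum). Exactly the three facts CutBondiMass.lean's docstring lists as "printed
  for Bondi–Sachs / conformal frameworks, NOT for intrinsic round families — to be assumed by route items in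
  this vocabulary"; here they are to be PROVED for the route's MGHDs. Why it might fail: peeling/roundness at
  `𝓘⁺` may fail for large data (only the sojourn form of completeness is assumed), and positivity needs a
  complete spanning hypersurface for cuts issuing from late shells that may dip inside the true horizon.
* `stub_loiteringFloor` (U — UNIFORM LOITERING FLOOR, the card's bet; size XL): under the package, for every
  `R₁ > ρ₀` carrying an honest ledger (EX)+(BB)+(ML), and every `D' > 0`, there are `ε > 0`, `L ≥ 0` with
  `cutBondiMass (K_i (t+L)) ≤ cutBondiMass (K_i t) − ε` whenever `i ≠ j` stay `D'`-close in the flat chart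
  throughout `[t, t+1]`, `t ≥ T`: two genuinely distinct certified near-Kerr throats (anti-twin clause 30,
  scale-covariant pin 22, `δ`-floor) within flat distance `D'` for a unit of time radiate at least `ε(D')` of
  rest mass through `𝓘⁺`, registered between hole `i`'s own tube cuts within lag `L(D', R₁)` (light-crossing
  of the `D' + R₁` neighbourhood at speeds `≤ V < 1`). The all-multipole "no non-radiating close pair"
  statement with UNIFORMITY; its zero-velocity shadow is the non-existence of stationary two-black-hole
  vacua (Neugebauer–Hennig arXiv:0905.4179), its qualitative core "no news on a retarded interval ⇒
  stationary there" is Alexakis–Schlue-type unique continuation from `𝓘⁺`. Why it might fail: uniformity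
  in `t` needs a compactness/limit argument over eras (C² pins give only C^{1,α} limits); the quadrupole
  flux alone vanishes for rigidly rotating Lagrange-type configurations, so ALL multipoles are needed; at
  early era times `[T, T'(ε))` the flat chart is metrically uncontrolled.

Composition `RadiativeLyapunovBudget_of : Sig.stub_bondiLedger → Sig.stub_loiteringFloor →
RadiativeLyapunovBudget` (the `Sig.*` legend = the stub signatures verbatim, so that the implication has
named binders; the registered stubs themselves are DEF-FREE and self-contained via `open … in`): take the
ledger's `R₁`, feed the ledger to the floor, set `E(t) := Σ_i cutBondiMass 𝒟 (K_i t)`; antitone on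
`[T, ∞)` by (ML) summand-wise, bounded below by `0` via `le_cutBondiMass` from (EX)+(BB), and coercive
because the `i`-th summand drops by `ε` within `L` while the others do not increase (`sum_le_sum_sub_of_drop`).
`radiativeLyapunovBudget_of_stubs : RadiativeLyapunovBudget` = the crux BY NAME, closed modulo the stubs.

Disproof.lean: none exists for this crux (`ledger crux ls stmt-FinalStateConjecture-10993`: no workfiles
at registration), so there is no `_false_without_` obligation to honour. Negatives index (1 entry,
`not_UniformPhotonSphereChannels`): an unrelated ODE channel estimate. Refuter finding honoured
(CruxAttack_RLB_rev2.md, ReductionRoute.lean): RLB ⟺ "package ⇒ pairwise dispersal"; neither stub is that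
statement or the crux reworded — K is Bondi bookkeeping without coercivity, U is a radiated-rest-mass
floor on geometry-pinned cuts (not an abstract `E`), and U's ledger hypothesis is discharged only by K.
-/

set_option linter.dupNamespace false

noncomputable section

open scoped Manifold ContDiff Topology BigOperators
open Filter Set Function Literature.Geometry.Lorentzian

namespace Summit.FinalStateConjecture.FinalStateConjecture.Cruxes.RadiativeLyapunovBudget.Birth

open Summit.FinalStateConjecture.FinalStateConjecture.Theses.DissipativeFinalMotions (RadiativeLyapunovBudget)

/-! ## Legend: the two stub statements as named propositions (verbatim the registered signatures) -/

/-- Statement of `stub_bondiLedger` (K): an honest, nested, nonnegative Bondi ledger on the hole-adapted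
tube cuts `∂J⁺(K_i t)`, `K_i(t) = Ψ₀({t ≤ y⁰, |y̲ − ξ_i(y⁰)| ≤ R₁})`, for some shell radius `R₁ > ρ₀`. -/
def Sig.stub_bondiLedger : Prop :=
  open Literature.Geometry.Lorentzian in open scoped Manifold ContDiff in ∀ (X : Type) [TopologicalSpace X] [ChartedSpace E3 X] [IsManifold (𝓡 3) ∞ X] [T2Space X] [SecondCountableTopology X] [ConnectedSpace X], ∀ D ∈ admissibleVacuumData X, ∀ 𝒟 : VacuumCauchyDevelopment D, 𝒟.IsMaximal → Summit.FinalStateConjecture.HasCompleteNullInfinity 𝒟.toCauchyDevelopment → ∀ (N : ℕ) (M a : Fin N → ℝ) (T δ V C₁ C₂ ρ₀ κ : ℝ) (ξ : Fin N → ℝ → E3) (β : ℝ → ℝ) (U₀ : TopologicalSpace.Opens E4) (B₀ : ModelBackground) (B : Fin N → ModelBackground) (Ψ₀ : B₀.domain → 𝒟.carrier) (Ψ : (i : Fin N) → (B i).domain → 𝒟.carrier) (O : Set 𝒟.carrier), 𝒟.toCauchyDevelopment.IsFinalEra₂ N M a T δ V C₁ C₂ ρ₀ κ ξ β U₀ B₀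 B Ψ₀ Ψ O → ∃ R₁ : ℝ, ρ₀ < R₁ ∧ ∀ (i : Fin N) (t : ℝ), T ≤ t → (∃ m : ℝ, 𝒟.toCauchyDevelopment.HasCutBondiMass (Ψ₀ '' {y : B₀.domain | t ≤ y.1 0 ∧ ‖E4.spatial y.1 - ξ i (y.1 0)‖ ≤ R₁}) m) ∧ (∀ m : ℝ, 𝒟.toCauchyDevelopment.HasCutBondiMass (Ψ₀ '' {y : B₀.domain | t ≤ y.1 0 ∧ ‖E4.spatial y.1 - ξ i (y.1 0)‖ ≤ R₁}) m → 0 ≤ m) ∧ (∀ s : ℝ, T ≤ s → s ≤ t → 𝒟.toCauchyDevelopment.cutBondiMass (Ψ₀ '' {y : B₀.domain | t ≤ y.1 0 ∧ ‖E4.spatial y.1 - ξ i (y.1 0)‖ ≤ R₁}) ≤ 𝒟.toCauchyDevelopment.cutBondiMass (Ψ₀ '' {y : B₀.domain | s ≤ y.1 0 ∧ ‖E4.spatial y.1 - ξ i (y.1 0)‖ ≤ R₁}))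

/-- Statement of `stub_loiteringFloor` (U): an honest ledger on the `R₁`-tube cuts is taxed by at least
`ε(D') > 0` within lag `L(D')` after every unit of flat time during which two distinct labels are
`D'`-close. -/
def Sig.stub_loiteringFloor : Prop :=
  open Literature.Geometry.Lorentzian in open scoped Manifold ContDiff in ∀ (X : Type) [TopologicalSpace X] [ChartedSpace E3 X] [IsManifold (𝓡 3) ∞ X] [T2Space X] [SecondCountableTopology X] [ConnectedSpace X], ∀ D ∈ admissibleVacuumData X, ∀ 𝒟 : VacuumCauchyDevelopment D, 𝒟.IsMaximal → Summit.FinalStateConjecture.HasCompleteNullInfinity 𝒟.toCauchyDevelopment → ∀ (N : ℕ) (M a : Fin N → ℝ) (T δ V C₁ C₂ ρ₀ κ : ℝ) (ξ : Fin N → ℝ → E3) (β : ℝ → ℝ) (U₀ : TopologicalSpace.Opens E4) (B₀ : ModelBackground) (B : Fin N → ModelBackground) (Ψ₀ : B₀.domain → 𝒟.carrier) (Ψ : (i : Fin N) → (B i).domain → 𝒟.carrier) (O : Set 𝒟.carrier), 𝒟.toCauchyDevelopment.IsFinalEra₂ N M a T δ V C₁ C₂ ρ₀ κ ξ β U₀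 B₀ B Ψ₀ Ψ O → ∀ R₁ : ℝ, ρ₀ < R₁ → (∀ (i : Fin N) (t : ℝ), T ≤ t → (∃ m : ℝ, 𝒟.toCauchyDevelopment.HasCutBondiMass (Ψ₀ '' {y : B₀.domain | t ≤ y.1 0 ∧ ‖E4.spatial y.1 - ξ i (y.1 0)‖ ≤ R₁}) m) ∧ (∀ m : ℝ, 𝒟.toCauchyDevelopment.HasCutBondiMass (Ψ₀ '' {y : B₀.domain | t ≤ y.1 0 ∧ ‖E4.spatial y.1 - ξ i (y.1 0)‖ ≤ R₁}) m → 0 ≤ m) ∧ (∀ s : ℝ, T ≤ s → s ≤ t → 𝒟.toCauchyDevelopment.cutBondiMass (Ψ₀ '' {y : B₀.domain | t ≤ y.1 0 ∧ ‖E4.spatial y.1 - ξ i (y.1 0)‖ ≤ R₁}) ≤ 𝒟.toCauchyDevelopment.cutBondiMass (Ψ₀ '' {y : B₀.domain | s ≤ y.1 0 ∧ ‖E4.spatial y.1 - ξ i (y.1 0)‖ ≤ R₁}))) → ∀ D' : ℝ, 0 < D' → ∃ ε L : ℝ, 0 < ε ∧ 0 ≤ L ∧ ∀ t : ℝ, T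 ≤ t → ∀ i j : Fin N, i ≠ j → (∀ s : ℝ, t ≤ s → s ≤ t + 1 → ‖ξ i s - ξ j s‖ ≤ D') → 𝒟.toCauchyDevelopment.cutBondiMass (Ψ₀ '' {y : B₀.domain | t + L ≤ y.1 0 ∧ ‖E4.spatial y.1 - ξ i (y.1 0)‖ ≤ R₁}) ≤ 𝒟.toCauchyDevelopment.cutBondiMass (Ψ₀ '' {y : B₀.domain | t ≤ y.1 0 ∧ ‖E4.spatial y.1 - ξ i (y.1 0)‖ ≤ R₁}) - ε

/-! ## Registered stubs (`sorry` only here; signatures def-free and self-contained) -/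

/-- **K — HONEST BONDI LEDGER ON HOLE-ADAPTED TUBE CUTS** (the route's layer-2 child `BondiBudget`, typed over
`CauchyDevelopment.HasCutBondiMass` / `cutBondiMass` of CutBondiMass.lean). For admissible data, an MGHD `𝒟`
with complete `𝓘⁺` and any rev-2 final era (`IsFinalEra₂`, the crux's 31 clauses): there is a shell radius
`R₁ > ρ₀` such that for every label `i` and every flat time `t ≥ T`, with
`K_i(t) := Ψ₀({y ∈ U₀ | t ≤ y⁰, |y̲ − ξ_i(y⁰)| ≤ R₁})` (the flat chart's image of the solid `R₁`-tube about
`ξ_i` after time `t`): (EX) some asymptotically round receding family of sections of `∂J⁺(K_i t)` has a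
Hawking-mass limit; (BB) every such limit is nonnegative (positivity of the Bondi energy of the cut in every
asymptotic frame); (ML) `cutBondiMass (K_i t) ≤ cutBondiMass (K_i s)` for `T ≤ s ≤ t` (mass loss between
the nested cuts `J⁺(K_i t) ⊆ J⁺(K_i s)` — nested by set inclusion, whence no time-orientation issue; for
rest masses, the reverse triangle inequality for the radiated four-momentum). Why plausibly true:
Christodoulou–Klainerman 1993 Ch. 17 (17.0.3/17.0.4/17.0.8) asymptotics, Bondi–van der Burg–Metzner 1962
§5 / Wald (11.2.13) mass loss, Schoen–Yau 1982 positivity — printed in the Bondi–Sachs / conformal / CK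
frameworks, to be transplanted to intrinsic round families in MGHDs of admissible data (CutBondiMass.lean,
"what is deliberately not vendored", (i)–(iii)). Why it might fail: only the sojourn form of complete `𝓘⁺`
is assumed (no peeling, no roundness of intrinsic cone sections for large data); cuts issuing from late
shells near `ρ₀` may dip inside the true horizon, so positivity needs the spanning-hypersurface argument
done with care. Sources: ChristodoulouKlainerman1993PMS41 (Ch. 17), SchoenYau1982, Wald1984 (§11.2),
arXiv:gr-qc/0307109. Size: L. -/
theorem stub_bondiLedger : open Literature.Geometry.Lorentzian in open scoped Manifold ContDiff in ∀ (X : Type) [TopologicalSpace X] [ChartedSpace E3 X] [IsManifold (𝓡 3) ∞ X] [T2Space X] [SecondCountableTopology X] [ConnectedSpace X], ∀ D ∈ admissibleVacuumData X, ∀ 𝒟 : VacuumCauchyDevelopment D, 𝒟.IsMaximal → Summit.FinalStateConjecture.HasCompleteNullInfinity 𝒟.toCauchyDevelopment → ∀ (N : ℕ) (M a : Fin N → ℝ) (T δ V C₁ C₂ ρ₀ κ : ℝ) (ξ : Fin N → ℝ → E3) (β : ℝ → ℝ) (U₀ : TopologicalSpace.Opens E4) (B₀ : ModelBackground) (B :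 Fin N → ModelBackground) (Ψ₀ : B₀.domain → 𝒟.carrier) (Ψ : (i : Fin N) → (B i).domain → 𝒟.carrier) (O : Set 𝒟.carrier), 𝒟.toCauchyDevelopment.IsFinalEra₂ N M a T δ V C₁ C₂ ρ₀ κ ξ β U₀ B₀ B Ψ₀ Ψ O → ∃ R₁ : ℝ, ρ₀ < R₁ ∧ ∀ (i : Fin N) (t : ℝ), T ≤ t → (∃ m : ℝ, 𝒟.toCauchyDevelopment.HasCutBondiMass (Ψ₀ '' {y : B₀.domain | t ≤ y.1 0 ∧ ‖E4.spatial y.1 - ξ i (y.1 0)‖ ≤ R₁}) m) ∧ (∀ m : ℝ, 𝒟.toCauchyDevelopment.HasCutBondiMass (Ψ₀ '' {y : B₀.domain | t ≤ y.1 0 ∧ ‖E4.spatial y.1 - ξ i (y.1 0)‖ ≤ R₁}) m → 0 ≤ m) ∧ (∀ s : ℝ, T ≤ s → s ≤ t → 𝒟.toCauchyDevelopment.cutBondiMass (Ψ₀ '' {y : B₀.domain | t ≤ y.1 0 ∧ ‖E4.spatial y.1 - ξ i (y.1 0)‖ ≤ R₁}) ≤ 𝒟.toCauchyDevelopment.cutBondiMass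 (Ψ₀ '' {y : B₀.domain | s ≤ y.1 0 ∧ ‖E4.spatial y.1 - ξ i (y.1 0)‖ ≤ R₁})) := by
  sorry

/-- **U — UNIFORM LOITERING FLOOR ON THE LEDGER** (the route's layer-2 child `LoiteringRadiates`, the card's
bet, typed over `cutBondiMass`). For admissible data, an MGHD `𝒟` with complete `𝓘⁺`, any rev-2 final era,
and any shell radius `R₁ > ρ₀` on whose tube cuts `K_i(t) = Ψ₀({t ≤ y⁰, |y̲ − ξ_i(y⁰)| ≤ R₁})` the Bondi ledger
is honest ((EX) round receding families with Hawking-mass limits, (BB) nonnegative limits, (ML) mass loss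
along `t`): for every `D' > 0` there are `ε > 0` and `L ≥ 0` such that whenever two DISTINCT labels `i ≠ j`
satisfy `|ξ_i(s) − ξ_j(s)| ≤ D'` for all flat times `s ∈ [t, t+1]`, `t ≥ T`, the rest mass of hole `i`'s cut
drops: `cutBondiMass (K_i (t+L)) ≤ cutBondiMass (K_i t) − ε`. Content: two genuinely distinct certified
near-Kerr throats (anti-twin clause 30, scale-covariant pin 22, separation floor `δ`, speeds `≤ V < 1`) that
stay `D'`-close for a unit of time radiate a four-momentum `F ≠ 0` through `𝓘⁺` between the cut of `K_i(t)`
(before the emission) and the cut of `K_i(t+L)` (after its arrival: `L` = light-crossing of the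
`D' + R₁`-neighbourhood, uniform because far-zone flatness (clause 20) and `V < 1` make flat time and the
tube's retarded time uniformly comparable), and `|P| − |P − F| ≥ ε(D')` UNIFORMLY over all such
configurations (all-multipole "no non-radiating close pair of black holes" + compactness over eras). Its
zero-velocity shadow is the non-existence of stationary two-black-hole vacua (Neugebauer–Hennig,
arXiv:0905.4179; Bunting–Masood-ul-Alam); its qualitative core "no news on a retarded interval ⇒ stationary
near `𝓘⁺`" is Alexakis–Schlue-type unique continuation from infinity; the `N = 2` toy is the dissipative
Kepler problem (Margheri–Ortega–Rebelo arXiv:1207.5001). Why it might fail: uniformity in `t` needs a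
limit argument over translated eras, but the `C²` pins of clauses 20/22 give only `C^{1,α}` subsequential
limits on which "zero radiated rest mass ⇒ stationary ⇒ no two holes" must be run; the quadrupole flux alone
vanishes for rigidly rotating Lagrange-type configurations, so the floor is genuinely all-multipole; at early
era times `[T, T'(ε))` the flat chart is metrically uncontrolled and the lag must absorb it. Sources:
arXiv:0905.4179, AlexakisSchlue2018, Blanchet2024 (§3), arXiv:1207.5001, MarchalSaari1976,
ChristodoulouKlainerman1993PMS41. Size: XL (open-problem flavoured). -/
theorem stub_loiteringFloor : open Literature.Geometry.Lorentzian in open scoped Manifold ContDiff in ∀ (X : Type) [TopologicalSpace X] [ChartedSpace E3 X] [IsManifold (𝓡 3) ∞ X] [T2Space X] [SecondCountableTopology X] [ConnectedSpace X], ∀ D ∈ admissibleVacuumData X, ∀ 𝒟 : VacuumCauchyDevelopment D, 𝒟.IsMaximal → Summit.FinalStateConjecture.HasCompleteNullInfinity 𝒟.toCauchyDevelopment → ∀ (N : ℕ) (M a : Fin N → ℝ) (T δ V C₁ C₂ ρ₀ κ : ℝ) (ξ : Fin N → ℝ → E3) (β : ℝ → ℝ) (U₀ : TopologicalSpace.Opens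 E4) (B₀ : ModelBackground) (B : Fin N → ModelBackground) (Ψ₀ : B₀.domain → 𝒟.carrier) (Ψ : (i : Fin N) → (B i).domain → 𝒟.carrier) (O : Set 𝒟.carrier), 𝒟.toCauchyDevelopment.IsFinalEra₂ N M a T δ V C₁ C₂ ρ₀ κ ξ β U₀ B₀ B Ψ₀ Ψ O → ∀ R₁ : ℝ, ρ₀ < R₁ → (∀ (i : Fin N) (t : ℝ), T ≤ t → (∃ m : ℝ, 𝒟.toCauchyDevelopment.HasCutBondiMass (Ψ₀ '' {y : B₀.domain | t ≤ y.1 0 ∧ ‖E4.spatial y.1 - ξ i (y.1 0)‖ ≤ R₁}) m) ∧ (∀ m : ℝ, 𝒟.toCauchyDevelopment.HasCutBondiMass (Ψ₀ '' {y : B₀.domain | t ≤ y.1 0 ∧ ‖E4.spatial y.1 - ξ i (y.1 0)‖ ≤ R₁}) m → 0 ≤ m) ∧ (∀ s : ℝ, T ≤ s → s ≤ t → 𝒟.toCauchyDevelopment.cutBondiMass (Ψ₀ '' {y : B₀.domain | t ≤ y.1 0 ∧ ‖E4.spatial y.1 - ξ i (y.1 0)‖ ≤ R₁}) ≤ 𝒟.toCauchyDevelopment.cutBondiMass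 (Ψ₀ '' {y : B₀.domain | s ≤ y.1 0 ∧ ‖E4.spatial y.1 - ξ i (y.1 0)‖ ≤ R₁}))) → ∀ D' : ℝ, 0 < D' → ∃ ε L : ℝ, 0 < ε ∧ 0 ≤ L ∧ ∀ t : ℝ, T ≤ t → ∀ i j : Fin N, i ≠ j → (∀ s : ℝ, t ≤ s → s ≤ t + 1 → ‖ξ i s - ξ j s‖ ≤ D') → 𝒟.toCauchyDevelopment.cutBondiMass (Ψ₀ '' {y : B₀.domain | t + L ≤ y.1 0 ∧ ‖E4.spatial y.1 - ξ i (y.1 0)‖ ≤ R₁}) ≤ 𝒟.toCauchyDevelopment.cutBondiMass (Ψ₀ '' {y : B₀.domain | t ≤ y.1 0 ∧ ‖E4.spatial y.1 - ξ i (y.1 0)‖ ≤ R₁}) - ε := by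
  sorry

/-! ## Composition: the crux BY NAME from the two stubs (real proof, no `sorry`) -/

/-- Finite sums of ledgers: if every summand does not increase and the `i`-th one drops by `ε`, the sum
drops by `ε`. [folklore] -/
theorem sum_le_sum_sub_of_drop {ι : Type*} [Fintype ι] {f g : ι → ℝ} {i : ι} {ε : ℝ}
    (hi : g i ≤ f i - ε) (h : ∀ k, g k ≤ f k) : ∑ k, g k ≤ ∑ k, f k - ε := by
  classical
  calc ∑ k, g k = g i + ∑ k ∈ Finset.univ.erase i, g k :=
        (Finset.add_sum_erase Finset.univ g (Finset.mem_univ i)).symm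
    _ ≤ (f i - ε) + ∑ k ∈ Finset.univ.erase i, f k :=
        add_le_add hi (Finset.sum_le_sum fun k _ ↦ h k)
    _ = (f i + ∑ k ∈ Finset.univ.erase i, f k) - ε := by ring
    _ = ∑ k, f k - ε := by rw [Finset.add_sum_erase Finset.univ f (Finset.mem_univ i)]

/-- **RLB from K and U.** Pointwise in the development and the era: K supplies the shell radius `R₁` and the
honest ledger on the hole-adapted tube cuts; U, fed that ledger, supplies the uniform floor; the witness is
the SUM over labels of the cut rest masses, `E(t) := Σ_i cutBondiMass 𝒟 (K_i t)` — antitone on `[T, ∞)`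
summand-wise by (ML), bounded below by `0` through `le_cutBondiMass` from (EX)+(BB), and coercive because
after a `D'`-close unit interval of the pair `(i, j)` the `i`-th summand drops by `ε` within `L` while no
summand increases. -/
theorem RadiativeLyapunovBudget_of :
    Sig.stub_bondiLedger → Sig.stub_loiteringFloor → RadiativeLyapunovBudget := by
  intro hK hU X _ _ _ _ _ _ D hD 𝒟 hmax hscri N M a T δ V C₁ C₂ ρ₀ κ ξ β U₀ B₀ B Ψ₀ Ψ O hera
  -- K: the shell radius and the honest ledger (the 31-clause inline hypothesis IS `IsFinalEra₂`, by `rfl`)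
  obtain ⟨R₁, hR₁, hled⟩ :=
    hK X D hD 𝒟 hmax hscri N M a T δ V C₁ C₂ ρ₀ κ ξ β U₀ B₀ B Ψ₀ Ψ O hera
  -- U: the floor on that ledger
  have hfloor := hU X D hD 𝒟 hmax hscri N M a T δ V C₁ C₂ ρ₀ κ ξ β U₀ B₀ B Ψ₀ Ψ O hera R₁ hR₁ hled
  -- the witness: the sum over labels of the cut rest masses of the hole-adapted tubes
  refine ⟨fun t ↦ ∑ i : Fin N, 𝒟.toCauchyDevelopment.cutBondiMass
      (Ψ₀ '' {y : B₀.domain | t ≤ y.1 0 ∧ ‖E4.spatial y.1 - ξ i (y.1 0)‖ ≤ R₁}), ?_, ?_, ?_⟩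
  · -- antitone on `[T, ∞)`: mass loss (ML) summand by summand
    intro s hs t ht hst
    exact Finset.sum_le_sum fun i _ ↦ (hled i t ht).2.2 s hs hst
  · -- bounded below by `0`: (EX) + (BB) through `le_cutBondiMass`
    refine ⟨0, ?_⟩
    rintro _ ⟨t, ht, rfl⟩
    exact Finset.sum_nonneg fun i _ ↦
      CauchyDevelopment.le_cutBondiMass (hled i t ht).1 (hled i t ht).2.1
  · -- coercive: the `i`-th summand is taxed by `ε` within `L`, the others do not increase
    intro D' hD'
    obtain ⟨ε, L, hε, hL, hc⟩ := hfloor D' hD'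
    refine ⟨ε, L, hε, hL, fun t ht i j hij hclose ↦ ?_⟩
    have hi := hc t ht i j hij hclose
    have hrest : ∀ k : Fin N,
        𝒟.toCauchyDevelopment.cutBondiMass
            (Ψ₀ '' {y : B₀.domain | t + L ≤ y.1 0 ∧ ‖E4.spatial y.1 - ξ k (y.1 0)‖ ≤ R₁}) ≤
          𝒟.toCauchyDevelopment.cutBondiMass
            (Ψ₀ '' {y : B₀.domain | t ≤ y.1 0 ∧ ‖E4.spatial y.1 - ξ k (y.1 0)‖ ≤ R₁}) :=
      fun k ↦ (hled k (t + L) (by linarith)).2.2 t ht (by linarith)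
    exact sum_le_sum_sub_of_drop hi hrest

/-- The crux by name, closed modulo the two registered stubs. -/
theorem radiativeLyapunovBudget_of_stubs : RadiativeLyapunovBudget :=
  RadiativeLyapunovBudget_of stub_bondiLedger stub_loiteringFloor

end Summit.FinalStateConjecture.FinalStateConjecture.Cruxes.RadiativeLyapunovBudget.Birth

end
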